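import Summits.Ventures.PercRepro.ExcessOneTraceIdentity

/-!
# The excess split at a tightening direction: the two shapes of the partner family

Dossier proofs/MINE1-theoremS.md, Addendum 44 (the tightening analog of the first half of
Theorem (NT)). For a family `F` and an element `r` write `K = partner r F` (the members `k` with
`k, insert r k ∈ F`), `F₀ = part0 r F`, `F₁ = partr r F`, `X = diffsX r F`, `Y = diffsY r F`. Two
families of differences lie in `X ∩ Y` for every `F` and `r`: `t ∖ k` for `t ∈ F₁`, `k ∈ K`
(`sdiff_mem_inter_of_mem_partr_of_mem_partner`) and `k ∖ p` for `k ∈ K`, `p ∈ F₀`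
(`sdiff_mem_inter_of_mem_partner_of_mem_part0`); both contain `K ∖∖ K`. At a **tightening
direction** of an excess-one family — `Tight (proj r F)`, i.e. `|X ∩ Y| = |K| + 1` (the trace
identity, ExcessOneTraceIdentity.lean) — this leaves exactly two shapes (`tightening_split`):
* (α) `K` is tight and `X ∩ Y = K ∖∖ K ∪ {e}` for a single extra difference `e`, or
* (β) `|K ∖∖ K| = |K| + 1` and `F₁ ∖∖ K = K ∖∖ F₀ = K ∖∖ K = X ∩ Y`.
In particular `|K ∖∖ K| ≤ |K| + 1` (`card_diffs_partner_le`): the partner family of a tightening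
direction has Marica–Schönheim excess at most one.
-/

namespace PercRepro.MSTight

open Finset
open scoped FinsetFamily

variable {α : Type*} [DecidableEq α] {r : α} {F : Finset (Finset α)}

/-- `t ∖ k ∈ X ∩ Y` for a member `insert r t` and a partner member `k`. -/
theorem sdiff_mem_inter_of_mem_partr_of_mem_partner {t k : Finset α} (ht : t ∈ partr r F)
    (hk : k ∈ partner r F) : t \ k ∈ diffsX r F ∩ diffsY r F := by
  obtain ⟨hrt, htF⟩ := mem_partr.1 ht
  have hkF : k ∈ F := (mem_part0.1 (mem_inter.1 hk).1).1
  have hrk : r ∉ k := (mem_part0.1 (mem_inter.1 hk).1).2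
  have hkF' : insert r k ∈ F := (mem_partr.1 (mem_inter.1 hk).2).2
  refine mem_inter.2 ⟨mem_diffsX_iff.2 ⟨?_, fun h => hrt (mem_sdiff.1 h).1⟩,
    mem_diffsY_iff.2 ⟨fun h => hrt (mem_sdiff.1 h).1, ?_⟩⟩
  · refine mem_diffs.2 ⟨insert r t, htF, insert r k, hkF', ?_⟩
    rw [insert_sdiff_insert, sdiff_insert_of_notMem hrt]
  · refine mem_diffs.2 ⟨insert r t, htF, k, hkF, ?_⟩
    rw [insert_sdiff_of_notMem _ hrk]

/-- `k ∖ p ∈ X ∩ Y` for a partner member `k` and a member `p` avoiding `r`. -/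
theorem sdiff_mem_inter_of_mem_partner_of_mem_part0 {k p : Finset α} (hk : k ∈ partner r F)
    (hp : p ∈ part0 r F) : k \ p ∈ diffsX r F ∩ diffsY r F := by
  have hkF : k ∈ F := (mem_part0.1 (mem_inter.1 hk).1).1
  have hrk : r ∉ k := (mem_part0.1 (mem_inter.1 hk).1).2
  have hkF' : insert r k ∈ F := (mem_partr.1 (mem_inter.1 hk).2).2
  obtain ⟨hpF, hrp⟩ := mem_part0.1 hp
  refine mem_inter.2 ⟨mem_diffsX_iff.2 ⟨mem_diffs.2 ⟨k, hkF, p, hpF, rfl⟩,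
    fun h => hrk (mem_sdiff.1 h).1⟩, mem_diffsY_iff.2 ⟨fun h => hrk (mem_sdiff.1 h).1, ?_⟩⟩
  refine mem_diffs.2 ⟨insert r k, hkF', p, hpF, ?_⟩
  rw [insert_sdiff_of_notMem _ hrp]

/-- `F₁ ∖∖ K ⊆ X ∩ Y`. -/
theorem partr_diffs_partner_subset : partr r F \\ partner r F ⊆ diffsX r F ∩ diffsY r F := by
  intro E hE
  obtain ⟨t, ht, k, hk, rfl⟩ := mem_diffs.1 hE
  exact sdiff_mem_inter_of_mem_partr_of_mem_partner ht hk

/-- `K ∖∖ F₀ ⊆ X ∩ Y`. -/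
theorem partner_diffs_part0_subset : partner r F \\ part0 r F ⊆ diffsX r F ∩ diffsY r F := by
  intro E hE
  obtain ⟨k, hk, p, hp, rfl⟩ := mem_diffs.1 hE
  exact sdiff_mem_inter_of_mem_partner_of_mem_part0 hk hp

/-- `K ⊆ F₁`. -/
theorem partner_subset_partr : partner r F ⊆ partr r F := inter_subset_right

/-- `K ⊆ F₀`. -/
theorem partner_subset_part0 : partner r F ⊆ part0 r F := inter_subset_left

/-- `K ∖∖ K ⊆ F₁ ∖∖ K`. -/
theorem diffs_partner_subset_partr_diffs : partner r F \\ partner r F ⊆ partr r F \\ partner r F :=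
  diffs_subset partner_subset_partr (subset_refl _)

/-- `K ∖∖ K ⊆ K ∖∖ F₀`. -/
theorem diffs_partner_subset_diffs_part0 : partner r F \\ partner r F ⊆ partner r F \\ part0 r F :=
  diffs_subset (subset_refl _) partner_subset_part0

section Tightening

variable (hF : (F \\ F).card = F.card + 1) (hP : Tight (proj r F))
include hF hP

/-- **At a tightening direction the partner family has Marica–Schönheim excess at most one.** -/
theorem card_diffs_partner_le : (partner r F \\ partner r F).card ≤ (partner r F).card + 1 := by
  have h1 := card_le_card (diffs_partner_subset r F)
  have h2 := (tight_proj_iff_card_edges hF r).1 hP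
  omega

/-- **The excess split at a tightening direction.** Either (α) `K` is tight and `X ∩ Y` is
`K ∖∖ K` plus one extra difference `e`, or (β) `|K ∖∖ K| = |K| + 1` and
`X ∩ Y = K ∖∖ K = F₁ ∖∖ K = K ∖∖ F₀`. -/
theorem tightening_split :
    (Tight (partner r F) ∧ ∃ e, e ∉ partner r F \\ partner r F ∧
      diffsX r F ∩ diffsY r F = insert e (partner r F \\ partner r F)) ∨
    ((partner r F \\ partner r F).card = (partner r F).card + 1 ∧
      diffsX r F ∩ diffsY r F = partner r F \\ partner r F ∧
      partr r F \\ partner r F = partner r F \\ partner r F ∧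
      partner r F \\ part0 r F = partner r F \\ partner r F) := by
  have h1 := card_le_card (diffs_partner_subset r F)
  have h2 := (tight_proj_iff_card_edges hF r).1 hP
  have h3 : (partner r F).card ≤ (partner r F \\ partner r F).card := card_le_card_diffs _
  by_cases hT : (partner r F \\ partner r F).card = (partner r F).card
  · left
    refine ⟨hT, ?_⟩
    obtain ⟨e, he, heK⟩ := exists_mem_notMem_of_card_lt_card
      (show (partner r F \\ partner r F).card < (diffsX r F ∩ diffsY r F).card by omega)
    refine ⟨e, heK, ?_⟩
    symm
    apply eq_of_subset_of_card_le
    · exact insert_subset he (diffs_partner_subset r F)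
    · rw [card_insert_of_notMem heK]; omega
  · right
    have hcard : (partner r F \\ partner r F).card = (partner r F).card + 1 := by omega
    have heq : diffsX r F ∩ diffsY r F = partner r F \\ partner r F :=
      (eq_of_subset_of_card_le (diffs_partner_subset r F) (by omega)).symm
    refine ⟨hcard, heq, ?_, ?_⟩
    · exact Subset.antisymm (heq ▸ partr_diffs_partner_subset) diffs_partner_subset_partr_diffs
    · exact Subset.antisymm (heq ▸ partner_diffs_part0_subset) diffs_partner_subset_diffs_part0

end Tightening

end PercRepro.MSTight
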